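import Literature.Geometry.Symplectic.PlanarMonodromy
import Literature.Geometry.Symplectic.GirouxContactPathNbhd
import Literature.Geometry.Manifold.OpenEmbeddingCriterion
import Literature.Topology.FourManifolds.CircleDiffeotopy
import HarnessLib

/-!
# Towards `supportedPlanarMonodromy` (F-a), I: a supported open book can be re-tubed so as to
# be positively framed

Topic `Literature/Geometry/Symplectic`; sibling of `PlanarMonodromy.lean`, which holds the named fact
`Literature.Geometry.Symplectic.supportedPlanarMonodromy` (F-a of the vocabulary programme of the
crux `ConvexBisection.PlanarAcyclicBisectionRigidity`, `DictionaryDesign.md` §3 D-a): a planar open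
book supporting `ξ` through a Giroux form `α` admits a re-tubing `K'` with `K'.proj = K.proj`,
`K'.binding = K.binding`, still carrying the Giroux form `α`, POSITIVELY FRAMED for `α`
(`IsPositivelyFramed`), and a planar monodromy chart.  This file proves the framing half
(loc. cit., §2 Decision 2: *"Tube directions are a gauge freedom of `OpenBook`, so this is
achievable by re-tubing"*; the reviewer of p139672: *"`IsGirouxForm → α(b) ≠ 0` so positive framing
is reachable by reversing the `S¹`-direction of a tube, which leaves `OpenBook` and the
sign-symmetric `IsGirouxForm.binding` field intact"*).  Everything is PROVED; no named fact; the
definitions are the conditional flip `conj × id` of a tube (the reflection `circleConj` of the circle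
is the tree's, `CircleDiffeotopy.lean`) and the flipped open book.

* `circlePoint_eq_circlePoint_two_pi_mul` — the two circle parametrisations of the tree agree: `circlePoint t`
  (`PlanarMonodromy.lean`, angle `2πt`) is `Literature.Topology.FourManifolds.circlePoint (2πt)`
  (`Knots.lean`, angle `θ`);
* `coreVelocity_eq` — the velocity of the core `s ↦ tube i (circlePoint s, 0)` is
  `(2π · circleSpeed (2πs)) • coreTangent i (circlePoint s)`, a NONZERO multiple of the chart
  tangent vector of the binding used in `OpenBook.IsGirouxForm.binding`
  (`GirouxContactPathTube.lean`: the flat parametrisation `OpenBook.param` and its frame);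
* `IsGirouxForm.coreVelocity_sign` — for a Giroux form `α`, on each tube the function
  `s ↦ α(coreVelocity K i s)` is continuous (it is `2π` times the flat coefficient
  `((param i)^* α)(e₀)` along the axis, `GirouxContactPathNbhd.lean`) and vanishes nowhere
  (`IsGirouxForm.apply_binding_ne_zero`), hence has CONSTANT SIGN (intermediate value theorem);
* `tubeFlipMap`, `OpenBook.flip K ε` — the flip `conj × id` of `𝕊¹ × ℝ²` and the open book with
  the tubes `i` with `ε i = true` precomposed with it (same `k`, same `proj`, same
  binding; a smooth embedding with open range again, `isSmoothEmbedding_comp_of_inverse`,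
  `OpenEmbeddingCriterion.lean`); `IsGirouxForm.flip`: a Giroux form stays one (the binding
  condition `α(b) · (α ∧ dα)(b, e₁, e₂) > 0` is quadratic in `b`, and the flip multiplies `b` by a
  nonzero scalar); the flip NEGATES the core velocity of the flipped tubes
  (`apply_coreVelocity_flip_of_eq_true`);
* `IsGirouxForm.exists_flip_isPositivelyFramed`, `IsGirouxForm.exists_isPositivelyFramed` —
  **flipping exactly the negatively framed tubes gives an open book with the same `k`, `proj` and
  binding, with Giroux form `α`, positively framed for `α`**; combined with the tree's
  `OpenBook.exists_reindex` (one tube per binding component):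
  `IsGirouxForm.exists_isPositivelyFramed_pairwise_disjoint`.

What remains of F-a after this file is the monodromy chart proper (`OpenBook.HasPlanarMonodromy`:
the complement of thin tubes as the mapping torus of a homeomorphism of the model planar page, with
arc data), cf. the docstring of `supportedPlanarMonodromy`.

## References

* J. B. Etnyre, *Lectures on open book decompositions and contact structures*, Clay Math. Proc. 5
  (2006) (arXiv:math/0409402), §2 (binding oriented as the boundary of the pages) and Def. 3.2,
  proof of Lemma 3.3 (`α(∂/∂ψ) > 0` near the binding). [Etnyre2006]
* `Summits/SmoothPoincare4/SmoothPoincare4/Cruxes/PlanarAcyclicBisectionRigidity/DictionaryDesign.md`,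
  §2 Decision 2.
-/

noncomputable section

open scoped Manifold ContDiff Topology
open Set Function Filter
open Literature.Geometry.Kaehler
open Literature.Topology.FourManifolds (circleConj circleConj_circleConj)

namespace Literature.Geometry.Symplectic

/-- Local notation: `𝔼 n` is the model Euclidean space `EuclideanSpace ℝ (Fin n)`. -/
local notation "𝔼 " n:arg => EuclideanSpace ℝ (Fin n)

/-- Local notation: `𝕊 n` is the unit sphere in `EuclideanSpace ℝ (Fin (n + 1))`. -/
local notation "𝕊 " n:arg => (Metric.sphere (0 : EuclideanSpace ℝ (Fin (n + 1))) 1)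

universe u

variable {N : Type u} [TopologicalSpace N] [ChartedSpace (𝔼 3) N] [IsManifold (𝓡 3) ∞ N]

/-! ### The two circle parametrisations; the core curve through the flat parametrisation -/

/-- **The two circle parametrisations of the tree agree**: `circlePoint t` (angle `2πt`,
`PlanarMonodromy.lean`) is `Literature.Topology.FourManifolds.circlePoint (2πt)` (angle `θ`,
`Knots.lean`). [folklore] -/
theorem circlePoint_eq_circlePoint_two_pi_mul (t : ℝ) :
    circlePoint t = Literature.Topology.FourManifolds.circlePoint (2 * Real.pi * t) :=
  rfl

/-- The axis of the flat model of a tube, run at speed `2π`: the linear map `s ↦ (2πs, 0, 0)`.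
[folklore] -/
def coreAxisLine : ℝ →L[ℝ] 𝔼 3 :=
  ContinuousLinearMap.smulRight (1 : ℝ →L[ℝ] ℝ) ((2 * Real.pi) • stdBasis3 0)

/-- `coreAxisLine s = (2πs, 0, 0) = mk3 (2πs) 0`. [folklore] -/
theorem coreAxisLine_apply (s : ℝ) : coreAxisLine s = OpenBook.mk3 (2 * Real.pi * s) 0 := by
  ext j
  fin_cases j
  · simp [coreAxisLine, OpenBook.mk3, stdBasis3_apply]; ring
  · simp [coreAxisLine, OpenBook.mk3, stdBasis3_apply]
  · simp [coreAxisLine, OpenBook.mk3, stdBasis3_apply]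

/-- `coreAxisLine 1 = 2π • e₀`. [folklore] -/
theorem coreAxisLine_one : coreAxisLine 1 = (2 * Real.pi) • stdBasis3 0 := by
  simp [coreAxisLine]

/-- The core of the `i`-th tube at parameter `s` is the point of the flat parametrisation
`OpenBook.param i` (`GirouxContactPathTube.lean`) over the axis point `(2πs, 0, 0)`. [folklore] -/
theorem tube_circlePoint_eq_param (K : OpenBook N) (i : Fin K.k) (s : ℝ) :
    K.tube i (circlePoint s, 0) = K.param i (OpenBook.mk3 (2 * Real.pi * s) 0) := by
  rw [OpenBook.param_mk3, circlePoint_eq_circlePoint_two_pi_mul]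

/-- **The core curve is the flat parametrisation composed with the axis**:
`(s ↦ tube i (circlePoint s, 0)) = param i ∘ coreAxisLine`. [folklore] -/
theorem tube_circlePoint_eq_param_comp (K : OpenBook N) (i : Fin K.k) :
    (fun s : ℝ => K.tube i (circlePoint s, 0)) = K.param i ∘ coreAxisLine := by
  funext s
  rw [comp_apply, coreAxisLine_apply, tube_circlePoint_eq_param]

/-- The core curve is differentiable, with derivative `d(param) ∘ coreAxisLine`. [folklore] -/
theorem hasMFDerivAt_tube_circlePoint (K : OpenBook N) (i : Fin K.k) (s : ℝ) :
    HasMFDerivAt 𝓘(ℝ, ℝ) (𝓡 3) (fun s : ℝ => K.tube i (circlePoint s, 0)) s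
      ((mfderiv (𝓡 3) (𝓡 3) (K.param i) (coreAxisLine s)).comp coreAxisLine) := by
  rw [tube_circlePoint_eq_param_comp]
  have hp : HasMFDerivAt (𝓡 3) (𝓡 3) (K.param i) (coreAxisLine s)
      (mfderiv (𝓡 3) (𝓡 3) (K.param i) (coreAxisLine s)) :=
    (((K.contMDiff_param i) _).mdifferentiableAt (by simp)).hasMFDerivAt
  exact hp.comp s coreAxisLine.hasMFDerivAt

/-- The core curve is `C^∞`. [folklore] -/
theorem contMDiff_tube_circlePoint (K : OpenBook N) (i : Fin K.k) :
    ContMDiff 𝓘(ℝ, ℝ) (𝓡 3) ∞ fun s : ℝ => K.tube i (circlePoint s, 0) := by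
  rw [tube_circlePoint_eq_param_comp]
  exact (K.contMDiff_param i).comp coreAxisLine.contDiff.contMDiff

/-- **The velocity of the core** (`coreVelocity`, `PlanarMonodromy.lean`) is a nonzero multiple of
the chart tangent vector of the binding (`OpenBook.coreTangent`, `PlanarContactBoundary.lean`):
`coreVelocity K i s = (2π · circleSpeed (2πs)) • coreTangent i (circlePoint s)`, where
`circleSpeed θ ≠ 0` is the chart coordinate of the velocity of `θ ↦ e^{iθ}`
(`GirouxContactPathTube.lean`). [folklore] -/
theorem coreVelocity_eq (K : OpenBook N) (i : Fin K.k) (s : ℝ) :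
    coreVelocity K i s =
      ((2 * Real.pi * OpenBook.circleSpeed (2 * Real.pi * s)) • K.coreTangent i (circlePoint s) :
        𝔼 3) := by
  have h1 : coreVelocity K i s =
      mfderiv (𝓡 3) (𝓡 3) (K.param i) (coreAxisLine s) (coreAxisLine 1) := by
    rw [coreVelocity, (hasMFDerivAt_tube_circlePoint K i s).mfderiv]
    rfl
  have h2 : mfderiv (𝓡 3) (𝓡 3) (K.param i) (coreAxisLine s) (coreAxisLine 1) =
      (2 * Real.pi) • mfderiv (𝓡 3) (𝓡 3) (K.param i) (coreAxisLine s) (stdBasis3 0) := by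
    rw [coreAxisLine_one]
    exact ContinuousLinearMap.map_smul _ _ _
  have h3 : mfderiv (𝓡 3) (𝓡 3) (K.param i) (coreAxisLine s) (stdBasis3 0) =
      (OpenBook.circleSpeed (2 * Real.pi * s) • K.coreTangent i (circlePoint s) : 𝔼 3) := by
    rw [coreAxisLine_apply, OpenBook.mfderiv_param_stdBasis3_zero, OpenBook.mk3_apply_zero,
      OpenBook.πw_mk3, OpenBook.psiTangent_zero, ← circlePoint_eq_circlePoint_two_pi_mul]
  rw [h1, h2, h3]
  exact smul_smul _ _ _

/-- The coefficient `2π · circleSpeed (2πs)` of `coreVelocity_eq` is nonzero. [folklore] -/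
theorem two_pi_mul_circleSpeed_ne_zero (s : ℝ) :
    2 * Real.pi * OpenBook.circleSpeed (2 * Real.pi * s) ≠ 0 :=
  mul_ne_zero (mul_ne_zero two_ne_zero Real.pi_ne_zero) (OpenBook.circleSpeed_ne_zero _)

/-- **A `1`-form on the core velocity**:
`α(coreVelocity K i s) = 2π · circleSpeed (2πs) · α(coreTangent i (circlePoint s))`. [folklore] -/
theorem apply_coreVelocity (K : OpenBook N) (α : MForm (𝓡 3) N ℝ 1) (i : Fin K.k) (s : ℝ) :
    α (K.tube i (circlePoint s, 0)) ![coreVelocity K i s] =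
      2 * Real.pi * OpenBook.circleSpeed (2 * Real.pi * s) *
        α (K.tube i (circlePoint s, 0)) ![K.coreTangent i (circlePoint s)] := by
  rw [coreVelocity_eq]
  exact oneForm_apply_smul_vec _ _ _

/-- The flat coefficient `((param i)^*α)(e₀)` on the axis point `(2πs, 0, 0)` (`OpenBook.pullParam`,
`GirouxContactPathNbhd.lean`) is `circleSpeed (2πs) · α(coreTangent i (circlePoint s))`. [folklore] -/
theorem pullParam_axis (K : OpenBook N) (α : MForm (𝓡 3) N ℝ 1) (i : Fin K.k) (s : ℝ) :
    K.pullParam i α (OpenBook.mk3 (2 * Real.pi * s) 0) ![stdBasis3 0] =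
      OpenBook.circleSpeed (2 * Real.pi * s) *
        α (K.tube i (circlePoint s, 0)) ![K.coreTangent i (circlePoint s)] := by
  rw [OpenBook.pullParam_apply, Matrix.cons_val_zero, OpenBook.mfderiv_param_stdBasis3_zero,
    OpenBook.mk3_apply_zero, OpenBook.πw_mk3, OpenBook.psiTangent_zero,
    ← circlePoint_eq_circlePoint_two_pi_mul,
    ← tube_circlePoint_eq_param]
  exact oneForm_apply_smul_vec _ _ _

/-- The same value read through the flat model: `α(coreVelocity K i s)` is `2π` times the
coefficient `((param i)^*α)(e₀)` of the pulled-back form on the axis point `(2πs, 0, 0)`.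
[folklore] -/
theorem apply_coreVelocity_eq_pullParam (K : OpenBook N) (α : MForm (𝓡 3) N ℝ 1) (i : Fin K.k)
    (s : ℝ) :
    α (K.tube i (circlePoint s, 0)) ![coreVelocity K i s] =
      2 * Real.pi * K.pullParam i α (OpenBook.mk3 (2 * Real.pi * s) 0) ![stdBasis3 0] := by
  rw [apply_coreVelocity, pullParam_axis]
  ring

/-- **Continuity of `s ↦ α(coreVelocity K i s)` for a smooth `1`-form `α`** (continuity of the
coefficients of the smooth flat form `(param i)^*α`, `continuous_apply_of_isSmoothForm`).
[folklore] -/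
theorem continuous_apply_coreVelocity (K : OpenBook N) {α : MForm (𝓡 3) N ℝ 1}
    (hα : IsSmoothForm α) (i : Fin K.k) :
    Continuous fun s : ℝ => α (K.tube i (circlePoint s, 0)) ![coreVelocity K i s] := by
  have hmk : Continuous fun s : ℝ => OpenBook.mk3 (2 * Real.pi * s) (0 : 𝔼 2) :=
    continuous_mk3.comp ((continuous_const.mul continuous_id).prodMk continuous_const)
  have h2 : Continuous fun s : ℝ =>
      K.pullParam i α (OpenBook.mk3 (2 * Real.pi * s) 0) ![stdBasis3 0] :=
    (continuous_apply_of_isSmoothForm (OpenBook.isSmoothForm_pullParam i hα) ![stdBasis3 0]).comp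
      hmk
  have h3 : Continuous fun s : ℝ =>
      2 * Real.pi * K.pullParam i α (OpenBook.mk3 (2 * Real.pi * s) 0) ![stdBasis3 0] :=
    continuous_const.mul h2
  exact h3.congr fun s => (apply_coreVelocity_eq_pullParam K α i s).symm

/-- **Constant sign of the framing function of a Giroux form.**  For a Giroux form `α` of the open
book `K` and each tube `i`, either `α(coreVelocity K i s) > 0` for all `s` or `α(coreVelocity K i s) < 0`
for all `s`: the function is continuous (`continuous_apply_coreVelocity`) and vanishes nowhere
(`α` is positive on the positively oriented binding, `IsGirouxForm.apply_binding_ne_zero`, and the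
core velocity is a nonzero multiple of the chart tangent, `coreVelocity_eq`), and `ℝ` is connected
(intermediate value theorem). [cite: Etnyre2006, Def. 3.2 and proof of Lemma 3.3] -/
theorem OpenBook.IsGirouxForm.coreVelocity_sign {K : OpenBook N} {ξ : N → Submodule ℝ (𝔼 3)}
    {α : MForm (𝓡 3) N ℝ 1} (h : K.IsGirouxForm ξ α) (i : Fin K.k) :
    (∀ s, 0 < α (K.tube i (circlePoint s, 0)) ![coreVelocity K i s]) ∨
      (∀ s, α (K.tube i (circlePoint s, 0)) ![coreVelocity K i s] < 0) := by
  have hcont := continuous_apply_coreVelocity K h.smooth i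
  have hne : ∀ s, α (K.tube i (circlePoint s, 0)) ![coreVelocity K i s] ≠ 0 := fun s => by
    rw [apply_coreVelocity]
    exact mul_ne_zero (two_pi_mul_circleSpeed_ne_zero s) (h.apply_binding_ne_zero i _)
  by_contra hcon
  rw [not_or, not_forall, not_forall] at hcon
  obtain ⟨⟨a, ha⟩, ⟨b, hb⟩⟩ := hcon
  obtain ⟨c, hc⟩ :=
    intermediate_value_univ₂ hcont continuous_const (not_lt.1 ha) (not_lt.1 hb)
  exact hne c hc

/-! ### Reversing the direction of a tube: complex conjugation of the circle -/

/-- **Complex conjugation reverses the parametrisation of the circle**: for the tree's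
self-diffeomorphism `circleConj` of `𝕊¹` (`CircleDiffeotopy.lean`, `(x₀, x₁) ↦ (x₀, -x₁)`),
`conj (circlePoint s) = circlePoint (-s)`. [folklore] -/
theorem circleConj_circlePoint_eq (s : ℝ) : circleConj (circlePoint s) = circlePoint (-s) := by
  rw [circlePoint_eq_circlePoint_two_pi_mul, circlePoint_eq_circlePoint_two_pi_mul,
    Literature.Topology.FourManifolds.circleConj_circlePoint, mul_neg]

/-- Conditional conjugation: `condCircleConj true = conj`, `condCircleConj false = id`. [folklore] -/
def condCircleConj : Bool → (𝕊 1) → (𝕊 1)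
  | true => fun x => circleConj x
  | false => id

/-- Conditional conjugation is an involution. [folklore] -/
@[simp] theorem condCircleConj_condCircleConj (b : Bool) (x : 𝕊 1) :
    condCircleConj b (condCircleConj b x) = x := by
  cases b
  · rfl
  · exact circleConj_circleConj x

/-- Conditional conjugation is `C^∞`. [folklore] -/
theorem contMDiff_condCircleConj (b : Bool) :
    ContMDiff (𝓡 1) (𝓡 1) ∞ (condCircleConj b) := by
  cases b
  · exact contMDiff_id
  · exact circleConj.contMDiff

/-- The conditional flip `condCircleConj b × id` of `𝕊¹ × ℝ²`. [folklore] -/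
def tubeFlipMap (b : Bool) : (𝕊 1) × (𝔼 2) → (𝕊 1) × (𝔼 2) :=
  Prod.map (condCircleConj b) id

/-- The flip is an involution. [folklore] -/
@[simp] theorem tubeFlipMap_tubeFlipMap (b : Bool) (z : (𝕊 1) × (𝔼 2)) :
    tubeFlipMap b (tubeFlipMap b z) = z := by
  obtain ⟨x, w⟩ := z
  simp [tubeFlipMap]

/-- The flip is `C^∞`. [folklore] -/
theorem contMDiff_tubeFlipMap (b : Bool) :
    ContMDiff ((𝓡 1).prod 𝓘(ℝ, 𝔼 2)) ((𝓡 1).prod 𝓘(ℝ, 𝔼 2)) ∞ (tubeFlipMap b) :=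
  (contMDiff_condCircleConj b).prodMap contMDiff_id

/-- The flip is injective. [folklore] -/
theorem injective_tubeFlipMap (b : Bool) : Injective (tubeFlipMap b) :=
  Function.LeftInverse.injective (g := tubeFlipMap b) (tubeFlipMap_tubeFlipMap b)

/-- The flip as a homeomorphism (it is its own inverse). [folklore] -/
def tubeFlipHomeomorph (b : Bool) : (𝕊 1) × (𝔼 2) ≃ₜ (𝕊 1) × (𝔼 2) where
  toFun := tubeFlipMap b
  invFun := tubeFlipMap b
  left_inv := tubeFlipMap_tubeFlipMap b
  right_inv := tubeFlipMap_tubeFlipMap b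
  continuous_toFun := (contMDiff_tubeFlipMap b).continuous
  continuous_invFun := (contMDiff_tubeFlipMap b).continuous

/-- The flip is an open map. [folklore] -/
theorem isOpenMap_tubeFlipMap (b : Bool) : IsOpenMap (tubeFlipMap b) :=
  (tubeFlipHomeomorph b).isOpenMap

/-- The flip is surjective. [folklore] -/
theorem surjective_tubeFlipMap (b : Bool) : Surjective (tubeFlipMap b) :=
  Function.RightInverse.surjective (g := tubeFlipMap b) (tubeFlipMap_tubeFlipMap b)

attribute [local instance] OpenBook.nonempty_circleProd

/-- The model vector spaces of `𝕊¹ × ℝ²` and of a `3`-manifold have the same dimension.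
[folklore] -/
def circleProdPlaneModelEquiv : ((𝔼 1) × (𝔼 2)) ≃L[ℝ] (𝔼 3) :=
  ContinuousLinearEquiv.ofFinrankEq (by simp [Module.finrank_prod])

/-- **A tube precomposed with the flip is again a smooth open embedding** with the same image
(`isSmoothEmbedding_comp_of_inverse`, `OpenEmbeddingCriterion.lean`). [folklore] -/
theorem OpenBook.isSmoothEmbedding_tube_comp_tubeFlipMap (K : OpenBook N) (i : Fin K.k)
    (b : Bool) :
    Manifold.IsSmoothEmbedding ((𝓡 1).prod 𝓘(ℝ, 𝔼 2)) (𝓡 3) ∞ (K.tube i ∘ tubeFlipMap b) ∧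
      IsOpen (range (K.tube i ∘ tubeFlipMap b)) ∧
        range (K.tube i ∘ tubeFlipMap b) = range (K.tube i) := by
  obtain ⟨h1, h2, h3⟩ := Literature.Geometry.Manifold.isSmoothEmbedding_comp_of_inverse
    (K.isSmoothEmbedding_tube i) (K.isOpen_range_tube i) (contMDiff_tubeFlipMap b)
    (injective_tubeFlipMap b) (isOpenMap_tubeFlipMap b)
    ((contMDiff_tubeFlipMap b).contMDiffOn (s := range (tubeFlipMap b)))
    (tubeFlipMap_tubeFlipMap b) circleProdPlaneModelEquiv
  refine ⟨h1, h2, ?_⟩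
  rw [h3, (surjective_tubeFlipMap b).range_eq, image_univ]

/-! ### The flipped open book -/

namespace OpenBook

variable (K : OpenBook N) (ε : Fin K.k → Bool)

/-- The binding of the flipped tubes is the binding. [folklore] -/
theorem tubesBinding_flip :
    tubesBinding (fun i => K.tube i ∘ tubeFlipMap (ε i)) = K.binding := by
  ext y
  simp only [mem_tubesBinding_iff, K.mem_binding_iff, comp_apply, tubeFlipMap, Prod.map_apply,
    id_eq]
  constructor
  · rintro ⟨i, x, rfl⟩
    exact ⟨i, condCircleConj (ε i) x, rfl⟩
  · rintro ⟨i, x, rfl⟩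
    exact ⟨i, condCircleConj (ε i) x, by rw [condCircleConj_condCircleConj]⟩

/-- **The flipped open book `K.flip ε`**: the same binding tubes, those with `ε i = true`
precomposed with `conj × id` (the direction of their core reversed), the same fibration `proj`.
All axioms of `OpenBook` are insensitive to the direction of the cores (the normal form
`proj (tube (x, w)) = w / ‖w‖` does not involve `x`). [folklore] -/
def flip : OpenBook N where
  k := K.k
  k_pos := K.k_pos
  tube i := K.tube i ∘ tubeFlipMap (ε i)
  proj := K.proj
  isSmoothEmbedding_tube i := (K.isSmoothEmbedding_tube_comp_tubeFlipMap i (ε i)).1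
  isOpen_range_tube i := (K.isSmoothEmbedding_tube_comp_tubeFlipMap i (ε i)).2.1
  eq_zero_of_tube_eq i j x y w h :=
    K.eq_zero_of_tube_eq i j (condCircleConj (ε i) x) (condCircleConj (ε j) y) w h
  proj_tube i x w hw := K.proj_tube i (condCircleConj (ε i) x) w hw
  contMDiffOn_proj := by
    rw [K.tubesBinding_flip ε]
    exact K.contMDiffOn_proj
  angularDeriv_ne_zero y hy := by
    rw [K.tubesBinding_flip ε] at hy
    exact K.angularDeriv_ne_zero y hy

/-- The flipped open book has the same number of tubes. [folklore] -/
@[simp] theorem flip_k : (K.flip ε).k = K.k := rfl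

/-- The flipped open book has the same fibration. [folklore] -/
@[simp] theorem flip_proj : (K.flip ε).proj = K.proj := rfl

/-- The tubes of the flipped open book. [folklore] -/
theorem flip_tube_apply (i : Fin K.k) (x : 𝕊 1) (w : 𝔼 2) :
    (K.flip ε).tube i (x, w) = K.tube i (condCircleConj (ε i) x, w) := rfl

/-- The flipped open book has the same binding. [folklore] -/
@[simp] theorem flip_binding : (K.flip ε).binding = K.binding :=
  K.tubesBinding_flip ε

/-! ### The frame of a flipped tube at the binding -/

/-- The chart coordinate of `d(condCircleConj b)` on the unit chart vector of the circle.
[folklore] -/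
def condCircleConjSpeed (b : Bool) (x : 𝕊 1) : ℝ :=
  (show 𝔼 1 from
    mfderiv (𝓡 1) (𝓡 1) (condCircleConj b) x (EuclideanSpace.single (0 : Fin 1) (1 : ℝ))) 0

/-- `d(condCircleConj b)(1) = condCircleConjSpeed • 1` in the one-dimensional chart of the circle.
[folklore] -/
theorem mfderiv_condCircleConj_single (b : Bool) (x : 𝕊 1) :
    mfderiv (𝓡 1) (𝓡 1) (condCircleConj b) x (EuclideanSpace.single (0 : Fin 1) (1 : ℝ)) =
      condCircleConjSpeed b x • EuclideanSpace.single (0 : Fin 1) (1 : ℝ) :=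
  euclideanSpace_one_eq _

/-- `condCircleConjSpeed b x ≠ 0` (`condCircleConj b` is an involution, so its differential is
injective). [folklore] -/
theorem condCircleConjSpeed_ne_zero (b : Bool) (x : 𝕊 1) : condCircleConjSpeed b x ≠ 0 := by
  intro h0
  have hd : ∀ y, MDifferentiableAt (𝓡 1) (𝓡 1) (condCircleConj b) y := fun y =>
    (contMDiff_condCircleConj b y).mdifferentiableAt (by simp)
  -- `d(condCircleConj) ∘ d(condCircleConj) = id`
  have hcomp := mfderiv_comp x (hd (condCircleConj b x)) (hd x)
  have hid : condCircleConj b ∘ condCircleConj b = id := funext (condCircleConj_condCircleConj b)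
  rw [hid, mfderiv_id] at hcomp
  have key : (EuclideanSpace.single (0 : Fin 1) (1 : ℝ) : 𝔼 1) =
      mfderiv (𝓡 1) (𝓡 1) (condCircleConj b) (condCircleConj b x)
        (mfderiv (𝓡 1) (𝓡 1) (condCircleConj b) x (EuclideanSpace.single (0 : Fin 1) (1 : ℝ))) :=
    ContinuousLinearMap.ext_iff.1 hcomp (EuclideanSpace.single (0 : Fin 1) (1 : ℝ))
  rw [mfderiv_condCircleConj_single, h0, zero_smul] at key
  have key2 : (EuclideanSpace.single (0 : Fin 1) (1 : ℝ) : 𝔼 1) = 0 := key.trans (map_zero _)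
  have := congrArg (fun u : 𝔼 1 => u 0) key2
  simp at this

/-- The flipped tube is differentiable. [folklore] -/
theorem tube_mdifferentiableAt (i : Fin K.k) (z : (𝕊 1) × (𝔼 2)) :
    MDifferentiableAt ((𝓡 1).prod 𝓘(ℝ, 𝔼 2)) (𝓡 3) (K.tube i) z :=
  ((K.isSmoothEmbedding_tube i).contMDiff z).mdifferentiableAt (by simp)

/-- **The differential of a flipped tube on the core**: for `v ∈ T𝕊¹`, `u ∈ ℝ²`,
`d(tube ∘ flip)_{(x, w)} (v, u) = d(tube)_{(condCircleConj x, w)} (d(condCircleConj)_x v, u)`.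
[folklore] -/
theorem mfderiv_flip_tube_apply (i : Fin K.k) (x : 𝕊 1) (w : 𝔼 2) (v : 𝔼 1) (u : 𝔼 2) :
    mfderiv ((𝓡 1).prod 𝓘(ℝ, 𝔼 2)) (𝓡 3) ((K.flip ε).tube i) (x, w) (v, u) =
      mfderiv ((𝓡 1).prod 𝓘(ℝ, 𝔼 2)) (𝓡 3) (K.tube i) (condCircleConj (ε i) x, w)
        (mfderiv (𝓡 1) (𝓡 1) (condCircleConj (ε i)) x v, u) := by
  have hflip :
      MDifferentiableAt ((𝓡 1).prod 𝓘(ℝ, 𝔼 2)) ((𝓡 1).prod 𝓘(ℝ, 𝔼 2)) (tubeFlipMap (ε i)) (x, w) :=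
    (contMDiff_tubeFlipMap (ε i) (x, w)).mdifferentiableAt (by simp)
  have hcomp := mfderiv_comp (x, w) (K.tube_mdifferentiableAt i (tubeFlipMap (ε i) (x, w))) hflip
  have hpm : mfderiv ((𝓡 1).prod 𝓘(ℝ, 𝔼 2)) ((𝓡 1).prod 𝓘(ℝ, 𝔼 2)) (tubeFlipMap (ε i)) (x, w) =
      (mfderiv (𝓡 1) (𝓡 1) (condCircleConj (ε i)) x).prodMap
        (mfderiv 𝓘(ℝ, 𝔼 2) 𝓘(ℝ, 𝔼 2) (id : 𝔼 2 → 𝔼 2) w) :=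
    mfderiv_prodMap ((contMDiff_condCircleConj (ε i) x).mdifferentiableAt (by simp))
      mdifferentiableAt_id
  rw [mfderiv_id] at hpm
  show mfderiv ((𝓡 1).prod 𝓘(ℝ, 𝔼 2)) (𝓡 3) (K.tube i ∘ tubeFlipMap (ε i)) (x, w) (v, u) = _
  rw [hcomp, hpm]
  rfl

/-- **The chart tangent of the binding of a flipped tube is a nonzero multiple of the original one
at the conjugate point**: `coreTangent' i x = condCircleConjSpeed • coreTangent i (condCircleConj x)`.
[folklore] -/
theorem flip_coreTangent (i : Fin K.k) (x : 𝕊 1) :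
    (K.flip ε).coreTangent i x =
      condCircleConjSpeed (ε i) x • K.coreTangent i (condCircleConj (ε i) x) := by
  show mfderiv ((𝓡 1).prod 𝓘(ℝ, 𝔼 2)) (𝓡 3) ((K.flip ε).tube i) (x, 0)
      (EuclideanSpace.single (0 : Fin 1) (1 : ℝ), 0) = _
  rw [K.mfderiv_flip_tube_apply ε i x 0, mfderiv_condCircleConj_single]
  have key : mfderiv ((𝓡 1).prod 𝓘(ℝ, 𝔼 2)) (𝓡 3) (K.tube i) (condCircleConj (ε i) x, 0)
      (condCircleConjSpeed (ε i) x •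
        ((EuclideanSpace.single (0 : Fin 1) (1 : ℝ), (0 : 𝔼 2)) : (𝔼 1) × (𝔼 2))) =
      condCircleConjSpeed (ε i) x • K.coreTangent i (condCircleConj (ε i) x) :=
    ContinuousLinearMap.map_smul _ _ _
  rw [Prod.smul_mk, smul_zero] at key
  exact key

/-- **The meridional frame of a flipped tube is the original one at the conjugate point**:
`discFrame' i x j = discFrame i (condCircleConj x) j`. [folklore] -/
theorem flip_discFrame (i : Fin K.k) (x : 𝕊 1) (j : Fin 2) :
    (K.flip ε).discFrame i x j = K.discFrame i (condCircleConj (ε i) x) j := by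
  show mfderiv ((𝓡 1).prod 𝓘(ℝ, 𝔼 2)) (𝓡 3) ((K.flip ε).tube i) (x, 0)
      (0, EuclideanSpace.single j (1 : ℝ)) =
    mfderiv ((𝓡 1).prod 𝓘(ℝ, 𝔼 2)) (𝓡 3) (K.tube i) (condCircleConj (ε i) x, 0)
      (0, EuclideanSpace.single j (1 : ℝ))
  rw [K.mfderiv_flip_tube_apply ε i x 0]
  congr 1
  exact Prod.ext (map_zero _) rfl

/-- **A Giroux form stays a Giroux form for the flipped open book**: smoothness, kernel and the
contact condition do not involve the open book; the `pages` condition involves only `proj` and the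
binding, which are unchanged; the `binding` condition `α(b) · (α ∧ dα)(b, e₁, e₂) > 0` is quadratic
in `b` and is evaluated on the flipped frame `(c • b, e₁, e₂)`, `c ≠ 0`, at the conjugate point.
[cite: Etnyre2006, Def. 3.2] -/
theorem IsGirouxForm.flip {ξ : N → Submodule ℝ (𝔼 3)} {α : MForm (𝓡 3) N ℝ 1}
    (h : K.IsGirouxForm ξ α) : (K.flip ε).IsGirouxForm ξ α where
  smooth := h.smooth
  ker_eq := h.ker_eq
  contact := h.contact
  pages y hy := by
    rw [flip_binding] at hy
    exact h.pages y hy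
  binding i x := by
    rw [flip_coreTangent, flip_discFrame, flip_discFrame, flip_tube_apply]
    show 0 < bindMeasure α _ _ _ _
    rw [bindMeasure_smul]
    exact mul_pos (sq_pos_of_ne_zero (condCircleConjSpeed_ne_zero (ε i) x)) (h.bindMeasure_pos i _)

/-! ### The flip negates the core velocity of the flipped tubes -/

/-- The core curve of a flipped tube is the original core curve run backwards:
`s ↦ tube i (conj (circlePoint s), 0) = tube i (circlePoint (-s), 0)`. [folklore] -/
theorem flip_tube_circlePoint_of_eq_true {i : Fin K.k} (hi : ε i = true) :
    (fun s : ℝ => (K.flip ε).tube i (circlePoint s, 0)) =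
      (fun s : ℝ => K.tube i (circlePoint s, 0)) ∘ fun s : ℝ => -s := by
  funext s
  rw [flip_tube_apply, hi, comp_apply]
  show K.tube i (circleConj (circlePoint s), 0) = _
  rw [circleConj_circlePoint_eq]

/-- For an unflipped tube the core curve is unchanged. [folklore] -/
theorem flip_tube_circlePoint_of_eq_false {i : Fin K.k} (hi : ε i = false) :
    (fun s : ℝ => (K.flip ε).tube i (circlePoint s, 0)) =
      fun s : ℝ => K.tube i (circlePoint s, 0) := by
  funext s
  rw [flip_tube_apply, hi]
  rfl

/-- **The core velocity of a flipped tube is the negative of the original one at `-s`.**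
[folklore] -/
theorem coreVelocity_flip_of_eq_true {i : Fin K.k} (hi : ε i = true) (s : ℝ) :
    coreVelocity (K.flip ε) i s = -coreVelocity K i (-s) := by
  have hneg : HasMFDerivAt 𝓘(ℝ, ℝ) 𝓘(ℝ, ℝ) (fun s : ℝ => -s) s
      (-(ContinuousLinearMap.id ℝ ℝ)) :=
    (hasMFDerivAt_id (I := 𝓘(ℝ, ℝ)) s).neg
  have hγ := hasMFDerivAt_tube_circlePoint K i (-s)
  have hcomp := hγ.comp s hneg
  rw [coreVelocity, K.flip_tube_circlePoint_of_eq_true ε hi, hcomp.mfderiv, coreVelocity,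
    hγ.mfderiv]
  show (mfderiv (𝓡 3) (𝓡 3) (K.param i) (coreAxisLine (-s))).comp coreAxisLine (-(1 : ℝ)) =
    -((mfderiv (𝓡 3) (𝓡 3) (K.param i) (coreAxisLine (-s))).comp coreAxisLine (1 : ℝ))
  exact map_neg _ _

/-- The core velocity of an unflipped tube is unchanged. [folklore] -/
theorem coreVelocity_flip_of_eq_false {i : Fin K.k} (hi : ε i = false) (s : ℝ) :
    coreVelocity (K.flip ε) i s = coreVelocity K i s := by
  rw [coreVelocity, K.flip_tube_circlePoint_of_eq_false ε hi]
  rfl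

/-- **The framing function of a flipped tube** is MINUS the original framing function at `-s`.
[folklore] -/
theorem apply_coreVelocity_flip_of_eq_true (α : MForm (𝓡 3) N ℝ 1) {i : Fin K.k}
    (hi : ε i = true) (s : ℝ) :
    α ((K.flip ε).tube i (circlePoint s, 0)) ![coreVelocity (K.flip ε) i s] =
      -(α (K.tube i (circlePoint (-s), 0)) ![coreVelocity K i (-s)]) := by
  rw [K.coreVelocity_flip_of_eq_true ε hi, flip_tube_apply, hi]
  show α (K.tube i (circleConj (circlePoint s), 0)) ![-coreVelocity K i (-s)] = _
  rw [circleConj_circlePoint_eq]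
  have key : α (K.tube i (circlePoint (-s), 0)) ![((-1 : ℝ) • coreVelocity K i (-s))] =
      (-1 : ℝ) * α (K.tube i (circlePoint (-s), 0)) ![coreVelocity K i (-s)] :=
    oneForm_apply_smul_vec _ _ _
  rw [neg_one_smul, neg_one_mul] at key
  exact key

/-- The framing function of an unflipped tube is unchanged. [folklore] -/
theorem apply_coreVelocity_flip_of_eq_false (α : MForm (𝓡 3) N ℝ 1) {i : Fin K.k}
    (hi : ε i = false) (s : ℝ) :
    α ((K.flip ε).tube i (circlePoint s, 0)) ![coreVelocity (K.flip ε) i s] =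
      α (K.tube i (circlePoint s, 0)) ![coreVelocity K i s] := by
  rw [K.coreVelocity_flip_of_eq_false ε hi, flip_tube_apply, hi]
  rfl

end OpenBook

/-! ### Positive framing by flipping the negatively framed tubes -/

/-- The cores of the flipped open book have the same images as the original cores (conjugation
is a bijection of the circle). [folklore] -/
theorem OpenBook.range_flip_core (K : OpenBook N) (ε : Fin K.k → Bool) (i : Fin K.k) :
    range ((K.flip ε).core i) = range (K.core i) := by
  refine Subset.antisymm ?_ ?_
  · rintro _ ⟨x, rfl⟩
    exact ⟨condCircleConj (ε i) x, rfl⟩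
  · rintro _ ⟨x, rfl⟩
    exact ⟨condCircleConj (ε i) x, by
      show K.tube i (condCircleConj (ε i) (condCircleConj (ε i) x), 0) = K.tube i (x, 0)
      rw [condCircleConj_condCircleConj]⟩

/-- **Flipping exactly the negatively framed tubes gives a positively framed open book**: for a
Giroux form `α` of `K` there is a choice of flips `ε` (the tubes on which the constant-sign
framing function `s ↦ α(coreVelocity K i s)` of `IsGirouxForm.coreVelocity_sign` is negative) for
which `K.flip ε` is POSITIVELY FRAMED for `α` (`IsPositivelyFramed`, `PlanarMonodromy.lean`); it
still carries the Giroux form `α` by `IsGirouxForm.flip`.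
[cite: Etnyre2006, §2 (orientation of the binding) and Def. 3.2] -/
theorem OpenBook.IsGirouxForm.exists_flip_isPositivelyFramed {K : OpenBook N}
    {ξ : N → Submodule ℝ (𝔼 3)} {α : MForm (𝓡 3) N ℝ 1} (h : K.IsGirouxForm ξ α) :
    ∃ ε : Fin K.k → Bool, IsPositivelyFramed (K.flip ε) α := by
  classical
  set ε : Fin K.k → Bool := fun i =>
    decide (∀ s, α (K.tube i (circlePoint s, 0)) ![coreVelocity K i s] < 0) with hε
  refine ⟨ε, fun i s => ?_⟩
  by_cases hi : ∀ s, α (K.tube i (circlePoint s, 0)) ![coreVelocity K i s] < 0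
  · have hε' : ε i = true := by simp [hε, hi]
    rw [K.apply_coreVelocity_flip_of_eq_true ε α hε' s]
    linarith [hi (-s)]
  · have hε' : ε i = false := by simp [hε, hi]
    rw [K.apply_coreVelocity_flip_of_eq_false ε α hε' s]
    exact ((h.coreVelocity_sign i).resolve_right hi) s

/-- **A supported open book can be re-tubed so as to be positively framed.**  For a Giroux form
`α` of the open book `K` (for any plane field `ξ`) there is an open book `K'` with the same number
of tubes, the same fibration `proj` and the same binding, for which `α` is still a Giroux form,
and which is POSITIVELY FRAMED for `α`.  This is the framing half of the cite fact
`supportedPlanarMonodromy` (DictionaryDesign.md §2 Decision 2: *"Tube directions are a gauge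
freedom of `OpenBook`, so this is achievable by re-tubing"*).
[cite: Etnyre2006, §2 (orientation of the binding) and Def. 3.2] -/
theorem OpenBook.IsGirouxForm.exists_isPositivelyFramed {K : OpenBook N}
    {ξ : N → Submodule ℝ (𝔼 3)} {α : MForm (𝓡 3) N ℝ 1} (h : K.IsGirouxForm ξ α) :
    ∃ K' : OpenBook N, K'.k = K.k ∧ K'.proj = K.proj ∧ K'.binding = K.binding ∧
      K'.IsGirouxForm ξ α ∧ IsPositivelyFramed K' α := by
  obtain ⟨ε, hε⟩ := h.exists_flip_isPositivelyFramed
  exact ⟨K.flip ε, rfl, rfl, K.flip_binding ε, h.flip K ε, hε⟩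

/-- **One tube per binding component, positively framed.**  For a Giroux form `α` of an open book
`K` of a Hausdorff `3`-manifold there is an open book `K'` with the same fibration and binding,
still with Giroux form `α`, positively framed for `α`, whose cores are PAIRWISE DISJOINT (keep one
tube per binding component, `OpenBook.exists_reindex` / `IsGirouxForm.reindex` of
`GirouxContactPathTube.lean`, then flip the negatively framed tubes — flipping does not move the
cores, `OpenBook.range_flip_core`).  These are the two normalisations of the tube data that the
monodromy chart of `supportedPlanarMonodromy` presupposes (its matching `σ : Option (Fin n) ≃ Fin K'.k`
of page boundary circles with tubes is a bijection, and its boundary clause reads the cores in the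
boundary orientation of the page). [cite: Etnyre2006, §2 and Def. 3.2] -/
theorem OpenBook.IsGirouxForm.exists_isPositivelyFramed_pairwise_disjoint [T2Space N]
    {K : OpenBook N} {ξ : N → Submodule ℝ (𝔼 3)} {α : MForm (𝓡 3) N ℝ 1}
    (h : K.IsGirouxForm ξ α) :
    ∃ K' : OpenBook N, K'.proj = K.proj ∧ K'.binding = K.binding ∧ K'.IsGirouxForm ξ α ∧
      IsPositivelyFramed K' α ∧
      Pairwise fun a b => Disjoint (range (K'.core a)) (range (K'.core b)) := by
  obtain ⟨k', hk', f, hcover, hdisj⟩ := K.exists_reindex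
  have h₁ := h.reindex hk' f hcover
  obtain ⟨ε, hε⟩ := h₁.exists_flip_isPositivelyFramed
  refine ⟨(K.reindex hk' f hcover).flip ε, rfl, ?_, h₁.flip _ ε, hε, fun a b hab => ?_⟩
  · rw [OpenBook.flip_binding, OpenBook.reindex_binding]
  · show Disjoint (range (((K.reindex hk' f hcover).flip ε).core a))
      (range (((K.reindex hk' f hcover).flip ε).core b))
    rw [OpenBook.range_flip_core, OpenBook.range_flip_core]
    exact hdisj hab

end Literature.Geometry.Symplectic

end
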